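import Literature.NumberTheory.Rogawski1990.ArchTransfFamilyWallGeometry        -- (GLUE-X-dress) B1: swap∕sign-change CLEs, adapted basis, semiregular neighbourhoods
import Literature.Analysis.Calculus.SmoothGluingAcrossHyperplaneRay              -- ★ p850006 F0P3a-p02 (g19): `contDiffOn_extendFrom_of_tendsto_iteratedFDeriv_ray_basis`, `extendFrom_eq_self_of_contDiffOn`
import Literature.Analysis.Calculus.BoundedJetsLeibnizReflection                 -- ★ p850096 F0P3a-p02 (g19): Leibniz bounds, affine transport, reflection rays, the evenness killer
import Mathlib.Analysis.Normed.Module.FiniteDimension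
import HarnessLib

/-!
# (GLUE-X-dress) FILE B2 — the paired partner bracket `'F ∓ 'F∘s` of a Harish-Chandra family is `C^∞` across a `G`-wall near every semiregular point
# (Shelstad 1979 Thm. 4.7 p. 31; Bouaziz 1994 §3.2 (I₁)–(I₃) pp. 579–580)

Topic `NumberTheory/Rogawski1990`; namespace `Literature.NumberTheory.Rogawski1990`.  THEOREMS ONLY (no `def`, no instance, no notation, no axiom, no named fact, no `sorry`).
Cell `pub/hodgecm-mathlib`, crux H413 (`stmt-HodgeConjecture-24833`), F0∕P3c line LH3 (closer stub `stub_N9`, DIRECT ROAD «Transf», organ O-L2 `stub_N9transf`); brick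
**(GLUE-X-dress)** (LH3-plan (g2) 2026-09-02T06:35:47Z, architecture «=» 06:40:57Z), FILE B2 = THE BRACKET LEMMA, generic in the sign pattern `s`, the jump constants `jc′`
and the family `F` (no number field, no `α`): seat F0P3a-p09 (g5).

THE STATEMENT (`exists_nhds_contDiffOn_bracket`).  Let `F` lie in Harish-Chandra's space ★ `ArchHCSpaceG s jc′ F`, `S` a chart, `w ∉ S` a compact place, `i ≠ j` two slots with
non-zero signs, `q₀` a semiregular point of the wall `q w i = q w j` (★ `HcSemireg S w i j q₀`).  With the twisted member `'F = archERhoG S · F S`, the slot swap `s = hcSwapAt w i j`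
and `ε = (s w i)(s w j) ∈ {±1}`, there are an open `U ∋ q₀` and a function `N`, `C^∞` ON ALL OF `U`, equal OFF the wall to the bracket `'F(q) − ε·'F(s q)`.
* `ε = +1` (a compact wall of `G′_w`, realised Weyl reflection): ★ `InRegG s S` imposes nothing there, `U ⊆ InRegG s S` (B1 `mem_inRegG_of_sameSign`), so `'F` and `'F∘s` are
  `C^∞` on `U` by (I₁) and `N := 'F − 'F∘s` works outright.
* `ε = −1` (a NONCOMPACT wall, where `F S` jumps): `N := glue of 'F + 'F∘s`.  Off the wall `U ∩ {q w i ≠ q w j} ⊆ RegG S ⊆ InRegG s S` (B1), so `'F + 'F∘s` is `C^∞` there;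
  its jets are bounded near the wall ((I₁) bounds on compacts, Leibniz with the entire twist, affine transport through `s` — ★ `BoundedJetsLeibnizReflection`); along the
  normal ray `x + t·hcNrm` through a wall point `x ∈ U` (semiregular by B1) and on a word of adapted letters, (I₃) ★ `ArchHcJump` gives one-sided limits `L₊, L₋` of the jets
  of `'F` with `L₊ − L₋ = jc′·i^{#normal letters}·(Cayley word of 'F_{insert w S})(hcCayPt x)`; the reflected term has limits `σL₋, σL₊` (`σ = (−1)^{#normal letters}`,
  ★ `tendsto_iteratedFDeriv_add_comp_reflection_ray` with B1 `hcSwapAt_hcAdaptedVec`), so the sum has limits `L₊ + σL₋` and `L₋ + σL₊`: equal when `σ = 1`, and when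
  `σ = −1` because then the Cayley word has an odd number of `∂_x` letters and `'F_{insert w S}` is EVEN in `x_w` ((W).2 ★ `ArchHcWeyl` + B1 `archERhoG_negXAt_of_mem`,
  `negXAt_hcCayVec`, `negXAt_hcCayPt`; ★ `iteratedFDeriv_apply_eq_zero_of_comp_eq_self`), so the jump vanishes and `L₊ = L₋`.  ★ `contDiffOn_extendFrom_of_tendsto_
  iteratedFDeriv_ray_basis` (F0P3a-p02 (g19)) on the adapted basis (B1 `exists_basis_hcAdaptedVec`) then glues.
This is Shelstad's Thm. 4.7 mechanism «the `κ`-signature flips exactly where `Φ` jumps» in coordinates; FILE B3 sums the brackets over the partner labels.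
HONEST LABEL: HC_CM is proved only modulo the 7 printed citations (2 remaining named inputs: hLiu418 = `stmt-HodgeConjecture-24832`, h413 = `stmt-HodgeConjecture-24833`) until rung 0
closes; count-neutral calculus under O-L2, pays no organ.

## References
* [Shelstad1979] D. Shelstad, *Characters and inner forms of a quasi-split group over ℝ*, Compositio Math. 39 (1979) 11–45, §4 property (II) p. 23, Lemma 4.3 p. 25, Prop. 4.5
  p. 26, Thm. 4.7 (proof) p. 31.
* [Bouaziz1994IntegralesOrbitales] A. Bouaziz, *Intégrales orbitales sur les algèbres de Lie réductives*, Invent. Math. 115 (1994), §3.2 (I₁)–(I₃) pp. 579–580, Rem. 2 p. 594.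
* [Varadarajan1977] V. S. Varadarajan, *Harmonic Analysis on Real Reductive Groups*, LNM 576 (1977), Part I §1.12.
-/

open Function Set Filter Topology Finset Complex
open scoped ContDiff
open Literature.NumberTheory.Automorphic.ArchCartan Literature.Analysis.Calculus
open Literature.NumberTheory.Automorphic.Shelstad1979.StableOrbitalIntegrals

namespace Literature.NumberTheory.Rogawski1990

/-! ## §1 Signs -/

section Signs

/-- The product of two non-zero signs is `1` when they agree and `−1` when they differ. [cite: Shelstad1979, Thm. 4.7 proof p. 31] -/
theorem signType_intCast_mul_eq {a b : SignType} (ha : a ≠ 0) (hb : b ≠ 0) : ((a : ℤ) * (b : ℤ) : ℤ) = if a = b then 1 else -1 := by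
  revert a b; decide

end Signs

/-! ## §2 The bracket lemma -/

section Bracket

variable {W : Type*} [Fintype W] [DecidableEq W]

/-- **THE PAIRED PARTNER BRACKET IS `C^∞` ACROSS THE WALL.**  For `F` in Harish-Chandra's space ★ `ArchHCSpaceG s jc′ F`, a chart `S`, a compact place `w ∉ S`, slots `i ≠ j`
with non-zero signs and a semiregular wall point `q₀` (★ `HcSemireg S w i j q₀`): there are an open `U ∋ q₀` and `N : E → ℂ`, `C^∞` on `U`, with
`N q = 'F(q) − ε · 'F(hcSwapAt w i j q)` at every `q ∈ U` off the wall, where `'F = archERhoG S · F S` and `ε = (s w i)(s w j)`.  (`ε = 1`: no jump, plain (I₁); `ε = −1`: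
the jumps of `'F` and of its reflection cancel at every order by (I₃) and the evenness of the Cayley-side member in `x_w`.) [cite: Shelstad1979, Thm. 4.7 (p. 31); Prop. 4.5 (p. 26)]
[cite: Bouaziz1994IntegralesOrbitales, §3.2 (I₁)–(I₃) pp. 579–580] -/
theorem exists_nhds_contDiffOn_bracket {s : W → Fin 3 → SignType} {jc' : Finset W → W → Fin 3 → Fin 3 → ℂ} {F : Finset W → (W → Fin 3 → ℝ) → ℂ}
    (hF : ArchHCSpaceG s jc' F) {S : Finset W} {w : W} (hw : w ∉ S) {i j : Fin 3} (hij : i ≠ j) (hsi : s w i ≠ 0) (hsj : s w j ≠ 0)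
    {q₀ : W → Fin 3 → ℝ} (hq₀ : HcSemireg S w i j q₀) :
    ∃ U ∈ 𝓝 q₀, IsOpen U ∧ ∃ N : (W → Fin 3 → ℝ) → ℂ, ContDiffOn ℝ ∞ N U ∧
      ∀ q ∈ U, q w i ≠ q w j →
        N q = archERhoG S q * F S q - ((((s w i : ℤ) * (s w j : ℤ)) : ℤ) : ℂ) * (archERhoG S (hcSwapAt w i j q) * F S (hcSwapAt w i j q)) := by
  classical
  obtain ⟨U, hUo, hq₀U, hUswap, hU1, hU2, hU3, hU4⟩ := exists_nhds_hcSemireg hw hij hq₀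
  obtain ⟨A, hA⟩ := exists_continuousLinearEquiv_hcSwapAt (W := W) w i j
  -- the twisted member and its smoothness on `T_{in-reg}`
  have hI1 : ContDiffOn ℝ ∞ (F S) (InRegG s S) := (hF.2.2.1 S).1
  have hgI : ContDiffOn ℝ ∞ (fun c : W → Fin 3 → ℝ => archERhoG S c * F S c) (InRegG s S) := (contDiff_archERhoG S).contDiffOn.mul hI1
  have hεval := signType_intCast_mul_eq hsi hsj
  by_cases hs : s w i = s w j
  · /- SAME SIGNS: `U ⊆ InRegG s S`, the bracket `'F − 'F∘s` is smooth on `U` outright. -/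
    have hUin : U ⊆ InRegG s S := fun q hq => mem_inRegG_of_sameSign hij hs (hU2 q hq) (hU3 q hq)
    rw [if_pos hs] at hεval
    have hgU : ContDiffOn ℝ ∞ (fun c : W → Fin 3 → ℝ => archERhoG S c * F S c) U := hgI.mono hUin
    have hgAU : ContDiffOn ℝ ∞ (fun c : W → Fin 3 → ℝ => archERhoG S (hcSwapAt w i j c) * F S (hcSwapAt w i j c)) U := by
      have h : (fun c : W → Fin 3 → ℝ => archERhoG S (hcSwapAt w i j c) * F S (hcSwapAt w i j c)) = (fun c => archERhoG S c * F S c) ∘ A := by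
        funext c; rw [Function.comp_apply, hA]
      rw [h]
      exact hgU.comp A.contDiff.contDiffOn fun q hq => by rw [hA]; exact hUswap q hq
    refine ⟨U, hUo.mem_nhds hq₀U, hUo, fun q => archERhoG S q * F S q - ((((s w i : ℤ) * (s w j : ℤ)) : ℤ) : ℂ) *
      (archERhoG S (hcSwapAt w i j q) * F S (hcSwapAt w i j q)), hgU.sub (contDiffOn_const.mul hgAU), fun q _ _ => rfl⟩
  · /- OPPOSITE SIGNS: glue `'F + 'F∘s` across the wall. -/
    rw [if_neg hs] at hεval
    obtain ⟨ℓ, hℓ, hℓv⟩ := exists_clm_slotDiff (W := W) w hij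
    obtain ⟨b, hb⟩ := exists_basis_hcAdaptedVec (W := W) w hij
    -- the off-wall part of `U` is `G`-regular, hence in `T_{in-reg}`
    have hOin : U ∩ {y | ℓ y ≠ 0} ⊆ InRegG s S := by
      rintro q ⟨hqU, hq⟩
      refine regG_subset_inRegG s S (mem_regG_of_offWall hij (hU1 q hqU) (hU2 q hqU) (hU3 q hqU) (hU4 q hqU) fun h => hq ?_)
      show ℓ q = 0
      rw [hℓ, h, sub_self]
    have hO : IsOpen (U ∩ {y | ℓ y ≠ 0}) := hUo.inter (isOpen_setOf_apply_ne ℓ 0)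
    have hgO : ContDiffOn ℝ ∞ (fun c : W → Fin 3 → ℝ => archERhoG S c * F S c) (U ∩ {y | ℓ y ≠ 0}) := hgI.mono hOin
    have hAO : ∀ q ∈ U ∩ {y | ℓ y ≠ 0}, A q ∈ U ∩ {y | ℓ y ≠ 0} := by
      rintro q ⟨hqU, hq⟩
      refine ⟨by rw [hA]; exact hUswap q hqU, fun h => hq ?_⟩
      have h' : ℓ (A q) = 0 := h
      rw [hA, hℓ, (hcSwapAt_apply_pair w i j q).1, (hcSwapAt_apply_pair w i j q).2] at h'
      show ℓ q = 0
      rw [hℓ]; linarith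
    have hgAO : ContDiffOn ℝ ∞ ((fun c : W → Fin 3 → ℝ => archERhoG S c * F S c) ∘ A) (U ∩ {y | ℓ y ≠ 0}) :=
      hgO.comp A.contDiff.contDiffOn hAO
    have hN : ContDiffOn ℝ ∞ ((fun c : W → Fin 3 → ℝ => archERhoG S c * F S c) + (fun c : W → Fin 3 → ℝ => archERhoG S c * F S c) ∘ A)
        (U ∩ {y | ℓ y ≠ 0}) := hgO.add hgAO
    -- (I₁)-bounds for the twisted member on every compact, Leibniz with the entire twist
    have hbg : ∀ K : Set (W → Fin 3 → ℝ), IsCompact K → ∀ m : ℕ,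
        BddAbove ((fun y => ‖iteratedFDeriv ℝ m (fun c : W → Fin 3 → ℝ => archERhoG S c * F S c) y‖) '' (K ∩ InRegG s S)) :=
      fun K hK m => bddAbove_norm_iteratedFDeriv_mul_inter_of_isCompact (isOpen_inRegG s S) isOpen_univ hK (subset_univ _)
        (contDiff_archERhoG S).contDiffOn hI1 fun i _ => (hF.2.2.1 S).2.1 i K hK
    -- (hb) the jets of the bracket are bounded near every wall point
    have hbN : ∀ x ∈ U, ℓ x = 0 → ∀ n : ℕ, ∃ C : ℝ, ∀ᶠ y in 𝓝 x, ℓ y ≠ 0 →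
        ‖iteratedFDeriv ℝ n ((fun c : W → Fin 3 → ℝ => archERhoG S c * F S c) + (fun c : W → Fin 3 → ℝ => archERhoG S c * F S c) ∘ A) y‖ ≤ C := by
      intro x hxU _ n
      obtain ⟨r, hr, hrU⟩ := Metric.isOpen_iff.1 hUo x hxU
      set K : Set (W → Fin 3 → ℝ) := Metric.closedBall x (r / 2) with hKdef
      have hK : IsCompact K := isCompact_closedBall x (r / 2)
      have hKU : K ⊆ U := fun y hy => hrU (Metric.closedBall_subset_ball (by linarith) hy)
      have hbgO : BddAbove ((fun y => ‖iteratedFDeriv ℝ n (fun c : W → Fin 3 → ℝ => archERhoG S c * F S c) y‖) '' (K ∩ (U ∩ {y | ℓ y ≠ 0}))) :=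
        (hbg K hK n).mono (Set.image_mono (inter_subset_inter_right K hOin))
      have hbgAO : BddAbove ((fun y => ‖iteratedFDeriv ℝ n ((fun c : W → Fin 3 → ℝ => archERhoG S c * F S c) ∘ A) y‖) '' (K ∩ (U ∩ {y | ℓ y ≠ 0}))) := by
        have h1 : BddAbove ((fun y => ‖iteratedFDeriv ℝ n (fun c : W → Fin 3 → ℝ => archERhoG S c * F S c) y‖) ''
            ((fun y => A y + 0) '' (K ∩ (U ∩ {y | ℓ y ≠ 0})))) := by
          refine (hbg (A '' K) (hK.image A.continuous) n).mono (Set.image_mono ?_)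
          rintro _ ⟨y, hy, rfl⟩
          show A y + 0 ∈ ⇑A '' K ∩ InRegG s S
          rw [add_zero]
          exact ⟨mem_image_of_mem _ hy.1, hOin (hAO y hy.2)⟩
        have h2 := bddAbove_norm_iteratedFDeriv_comp_affine A 0 h1
        have h3 : (fun y => (fun c : W → Fin 3 → ℝ => archERhoG S c * F S c) (A y + 0)) = (fun c : W → Fin 3 → ℝ => archERhoG S c * F S c) ∘ A := by
          funext y; rw [add_zero, Function.comp_apply]
        rw [h3] at h2
        exact h2
      obtain ⟨C, hC⟩ := bddAbove_norm_iteratedFDeriv_add hO inter_subset_right hgO hgAO hbgO hbgAO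
      refine ⟨C, ?_⟩
      filter_upwards [Metric.closedBall_mem_nhds x (by linarith : (0 : ℝ) < r / 2), hUo.mem_nhds hxU] with y hyK hyU hy
      exact hC ⟨y, ⟨hyK, hyU, hy⟩, rfl⟩
    -- (hj) along the normal ray through a wall point, on adapted words, the two one-sided limits of the bracket's jets agree
    have hjN : ∀ x ∈ U, ℓ x = 0 → ∀ (n : ℕ) (k : Fin n → W × Fin 3), ∃ l : ℂ,
        Tendsto (fun t : ℝ => iteratedFDeriv ℝ n ((fun c : W → Fin 3 → ℝ => archERhoG S c * F S c) + (fun c : W → Fin 3 → ℝ => archERhoG S c * F S c) ∘ A)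
          (x + t • hcNrm w i j) fun r => b (k r)) (𝓝[>] 0) (𝓝 l) ∧
        Tendsto (fun t : ℝ => iteratedFDeriv ℝ n ((fun c : W → Fin 3 → ℝ => archERhoG S c * F S c) + (fun c : W → Fin 3 → ℝ => archERhoG S c * F S c) ∘ A)
          (x + t • hcNrm w i j) fun r => b (k r)) (𝓝[<] 0) (𝓝 l) := by
      intro x hxU hx n k
      have hxw : x w i = x w j := by
        have h := hℓ x
        rw [hx] at h
        linarith
      have hxs : HcSemireg S w i j x := hcSemireg_of_onWall hij (hU2 x hxU) (hU3 x hxU) (hU4 x hxU) hxw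
      have hword : (fun r => b (k r)) = fun r => hcAdaptedVec w i j (k r) := funext fun r => hb (k r)
      rw [hword]
      -- (I₃) at `x`: one-sided limits `Lp`, `Lm` of the twisted jets of `F S` along the normal, and their difference
      obtain ⟨Lp, Lm, hLp, hLm, hJ⟩ := hF.2.2.2.2 S w hw i j hij hs x hxs n k
      simp only [hcTwistedDeriv] at hLp hLm
      -- the reflection data
      have hAx : A x = x := by rw [hA]; exact hcSwapAt_eq_self_of_apply_eq w hxw
      have hAv : A (hcNrm w i j) = -hcNrm w i j := by rw [hA]; exact hcSwapAt_hcNrm w hij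
      have hm : ∀ r, A (hcAdaptedVec w i j (k r)) = (fun r => if k r = (w, i) then (-1 : ℝ) else 1) r • hcAdaptedVec w i j (k r) := fun r => by
        rw [hA]; exact hcSwapAt_hcAdaptedVec w hij (k r)
      have hray : ∀ᶠ t : ℝ in 𝓝[≠] 0, x + t • hcNrm w i j ∈ U ∩ {y | ℓ y ≠ 0} := by
        have h1 : Tendsto (fun t : ℝ => x + t • hcNrm w i j) (𝓝 0) (𝓝 x) := by
          have hc : Continuous (fun t : ℝ => x + t • hcNrm w i j) := by fun_prop
          have := hc.tendsto 0
          simpa using this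
        have h2 : ∀ᶠ t : ℝ in 𝓝 0, x + t • hcNrm w i j ∈ U := h1 (hUo.mem_nhds hxU)
        filter_upwards [nhdsWithin_le_nhds h2, self_mem_nhdsWithin] with t ht ht0
        refine ⟨ht, ?_⟩
        show ℓ (x + t • hcNrm w i j) ≠ 0
        rw [map_add, map_smul, hx, hℓv, zero_add, smul_eq_mul]
        exact mul_ne_zero ht0 two_ne_zero
      obtain ⟨hP, hM⟩ := tendsto_iteratedFDeriv_add_comp_reflection_ray A hAx hAv hO hgO hgAO hray n hm hLp hLm
      -- the sign of the word
      have hσ : (∏ r, (fun r => if k r = (w, i) then (-1 : ℝ) else 1) r) = 1 ∨ (∏ r, (fun r => if k r = (w, i) then (-1 : ℝ) else 1) r) = -1 := by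
        rw [prod_eq_neg_one_pow_card (fun r => letterSign_eq_one_or w i (k r))]
        exact neg_one_pow_eq_or ℝ _
      rcases hσ with hσ | hσ
      · refine ⟨Lp + (1 : ℝ) • Lm, ?_, ?_⟩
        · rw [hσ] at hP; exact hP
        · rw [hσ] at hM
          have h : Lm + (1 : ℝ) • Lp = Lp + (1 : ℝ) • Lm := by rw [one_smul, one_smul, add_comm]
          rw [h] at hM; exact hM
      · -- odd number of normal letters: the jump vanishes by evenness of the Cayley-side member in `x_w`
        have hz : hcTwistedDeriv (insert w S) n (fun r => hcCayVec w i j (k r)) (F (insert w S)) (hcCayPt w i j x) = 0 := by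
          obtain ⟨R, hR⟩ := exists_continuousLinearEquiv_negXAt (W := W) w
          unfold hcTwistedDeriv
          refine iteratedFDeriv_apply_eq_zero_of_comp_eq_self R ?_ ?_ n (ε := fun r => if k r = (w, i) then (-1 : ℝ) else 1) (fun r => ?_) hσ
          · funext c
            rw [Function.comp_apply, hR, archERhoG_negXAt_of_mem (Finset.mem_insert_self w S), hF.2.1.2 (insert w S) c w (Finset.mem_insert_self w S)]
          · rw [hR]; exact negXAt_hcCayPt w i j x
          · rw [hR]; exact negXAt_hcCayVec w i j (k r)
        rw [hz, mul_zero] at hJ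
        have hLL : Lp = Lm := sub_eq_zero.1 hJ
        refine ⟨Lp + (-1 : ℝ) • Lm, ?_, ?_⟩
        · rw [hσ] at hP; exact hP
        · rw [hσ] at hM; rw [hLL] at hM ⊢; exact hM
    -- glue
    have hglue := contDiffOn_extendFrom_of_tendsto_iteratedFDeriv_ray_basis ℓ 0 b (v := hcNrm w i j) (by rw [hℓv]; exact two_ne_zero) hUo hN hbN hjN
    refine ⟨U, hUo.mem_nhds hq₀U, hUo, _, hglue, fun q hqU hq => ?_⟩
    have hqO : q ∈ U ∩ {y | ℓ y ≠ 0} := ⟨hqU, fun h => hq (by have h' : ℓ q = 0 := h; rw [hℓ] at h'; linarith)⟩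
    rw [extendFrom_eq_self_of_contDiffOn hN hqO, hεval, Pi.add_apply, Function.comp_apply, hA]
    push_cast
    ring

end Bracket

end Literature.NumberTheory.Rogawski1990
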